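import Mathlib
import HarnessLib
import Summits.Ventures.LatticeQCDFlow.Exactness.NCMCGeneralSpaceOccupancyChain
import Summits.Ventures.LatticeQCDFlow.Exactness.NCMCGeneralSpaceOccupancyChainFlows
import Summits.Ventures.LatticeQCDFlow.Exactness.NCMCGeneralSpaceMarkovErgodicCriteria

/-!
# The NCMC lane's occupancy chain is ergodic as soon as the two level samplers are minorised — for every `c` and every protocol

HONEST FRAMING: exact (Metropolis-corrected) sampling algorithms for lattice gauge theory;
figures of merit are autocorrelation/cost numbers at stated couplings and volumes; no
continuum-physics claim.

Venture `LatticeQCDFlow` (cell pub-lqcd), topic `Exactness`; FANOUT row 13 (`eng-snf`, GEN-17).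
NEW WORK of the cell, not a published result; no definition is introduced; nothing is cited as a
fact.  Discharges the ergodicity hypothesis of `NCMCGeneralSpaceOccupancyChain.lean` for THE ENGINE'S
ITERATION KERNEL `Q = switchKernel κF κR c W s e ∘ₖ levelKernel T₀ T₁` of `latflow-snf`'s
`run_ncmc_chain` (relax at the current level with `T₀` / `T₁`, then the Metropolized switch of a
Crooks pair), through GEN-16's criterion `NCMCGeneralSpaceMarkovErgodic.ergodic_shift_chain`
(a stationary Markov chain is shift-ergodic iff its kernel charges no non-trivial almost-invariant
set) and the set-wise bookkeeping of `NCMCGeneralSpaceOccupancyChainFlows.lean` (lower bounds of one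
iteration through the level samplers; where Crooks' identity forces records to start and end).

## The certificate

Hypotheses: a Crooks pair `(κF, κR, s, e, W)` between finite non-zero level weights `ν₀`, `ν₁`;
Markov level samplers `T₀`, `T₁` leaving `ν₀`, `ν₁` invariant and each dominating one non-zero
measure from every configuration, `m₀ ≤ T₀(x, ·)`, `m₁ ≤ T₁(y, ·)` (row 9's heat-bath sweeps:
`heatBathSweep_minorised`).  NOTHING is assumed about `c`, about the work distribution or about the
acceptances.  Conclusion (`CrooksPair.ncmc_ae_invariant_trivial`): every measurable `B ⊆ Bool × Ω`
almost invariant for `Q` under `π_c` is `π_c`-trivial; hence (`CrooksPair.ergodic_ncmcChain`) the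
expanded-ensemble chain started in `π_c` is ergodic, and (`CrooksPair.tendsto_occupancy_ae_ncmcChain`,
`CrooksPair.tendsto_dFocc_ae_ncmcChain`) the reported occupancy converges to `σ(c − ΔF)` and
`dF_occ` to `ΔF` almost surely.

Proof.  (1) WITHIN A LEVEL (`ncmc_priorLevel_dichotomy`, `ncmc_targetLevel_dichotomy`): from a prior
state `(prior, x)` one iteration charges a target set `S` with mass
`≥ ∫ F_c(x', S) dm₀(x')` (relax into `m₀`, then an accepted forward switch); if the prior level met
both `B` and `Bᶜ` in positive mass, almost-invariance would kill `∫ F_c(x', B_target) dm₀` AND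
`∫ F_c(x', B_targetᶜ) dm₀`, i.e. `∫ F_c(x', Ω) dm₀ = 0` — impossible, the forward acceptance
`min(1, e^{−(W−c)})` is pointwise positive and `m₀ ≠ 0`.  (2) ACROSS LEVELS
(`ncmc_false_of_essTarget`, `ncmc_false_of_essPrior`): if `B` were (essentially) the whole target
level, Crooks' identity `e^{−W}(ν₀ ∘ κF) = ν₁ ∘ κR` with `e^{−W} > 0` makes forward records end
`ν₁`-almost surely inside `B_target`, so from `π_c`-almost every prior state the iteration enters `B`
with probability `≥ ∫ F_c(x', Ω) dm₀ > 0` (`m₀ ≪ ν₀` by invariance) — contradicting almost-invariance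
off `B`; symmetrically for the prior level with reverse records, which start `ν₀`-a.s. where they
should.  (3) The four combinations of (1) leave `π_c B ∈ {0, 1}` or one of the two cases of (2).

NOT CLAIMED: a one-step Doeblin minorisation of `Q` itself (false in general: the two accepted flows
live on different levels), hence no Hoeffding-type error bar from row 8's `Scoring/ChainHoeffding`;
rates; aperiodicity.
-/

namespace Summit.Ventures.LatticeQCDFlow.Exactness.GeneralNCMC

open MeasureTheory ProbabilityTheory Set Filter Finset
open scoped ENNReal Topology

variable {Ω E : Type*} [MeasurableSpace Ω] [MeasurableSpace E]

/-! ## §1 Almost-invariant sets of the iteration kernel are trivial -/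

section Trivial

variable {ν₀ ν₁ : Measure Ω} {κF κR : Kernel Ω E} [IsMarkovKernel κF] [IsMarkovKernel κR]
  {s e : E → Ω} {W : E → ℝ} {c : ℝ} {T₀ T₁ : Kernel Ω Ω} {m₀ m₁ : Measure Ω}

/-- **Within the prior level** (any measure `μ` carrying the almost-invariance): if `m₀ ≠ 0` lies
below every row of `T₀`, an almost-invariant `B` cannot split the prior level — `μ(B ∩ prior) = 0`
or `μ(Bᶜ ∩ prior) = 0`. -/
theorem ncmc_priorLevel_dichotomy (hW : Measurable W) (he : Measurable e) (hm₀ : m₀ univ ≠ 0)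
    (hmin₀ : ∀ z, m₀ ≤ T₀ z) {μ : Measure (Bool × Ω)} {B : Set (Bool × Ω)} (hB : MeasurableSet B)
    (hout : ∀ᵐ z ∂μ, z ∈ B → (switchKernel κF κR c W s e ∘ₖ levelKernel T₀ T₁) z Bᶜ = 0)
    (hin : ∀ᵐ z ∂μ, z ∉ B → (switchKernel κF κR c W s e ∘ₖ levelKernel T₀ T₁) z B = 0) :
    μ (B ∩ (targetLevel Ω)ᶜ) = 0 ∨ μ (Bᶜ ∩ (targetLevel Ω)ᶜ) = 0 := by
  by_contra hnot
  obtain ⟨hB1, hB2⟩ := not_or.1 hnot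
  -- a prior point of `B` that never leaves `B`, a prior point off `B` that never enters it
  obtain ⟨z, hz, hzout⟩ := exists_of_ae_imp
    (hout.mono fun z hz hzB => hz hzB.1 : ∀ᵐ z ∂μ, z ∈ B ∩ (targetLevel Ω)ᶜ → _) hB1
  obtain ⟨z', hz', hzin⟩ := exists_of_ae_imp
    (hin.mono fun z hz hzB => hz hzB.1 : ∀ᵐ z ∂μ, z ∈ Bᶜ ∩ (targetLevel Ω)ᶜ → _) hB2
  have hz1 : z = (false, z.2) := Prod.ext (Bool.eq_false_iff.2 (by simpa using hz.2)) rfl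
  have hz1' : z' = (false, z'.2) := Prod.ext (Bool.eq_false_iff.2 (by simpa using hz'.2)) rfl
  rw [hz1] at hzout
  rw [hz1'] at hzin
  have h1 : ∫⁻ x', fwdFlow κF c W e x' (Prod.mk true ⁻¹' Bᶜ) ∂m₀ = 0 :=
    le_antisymm ((lintegral_fwdFlow_le_iteration T₀ T₁ hW he (hmin₀ z.2) hB.compl).trans
      hzout.le) bot_le
  have h2 : ∫⁻ x', fwdFlow κF c W e x' (Prod.mk true ⁻¹' B) ∂m₀ = 0 :=
    le_antisymm ((lintegral_fwdFlow_le_iteration T₀ T₁ hW he (hmin₀ z'.2) hB).trans hzin.le)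
      bot_le
  have hsum : ∫⁻ x', fwdFlow κF c W e x' univ ∂m₀ = 0 := by
    have hBt : MeasurableSet (Prod.mk true ⁻¹' B) := measurable_prodMk_left hB
    calc ∫⁻ x', fwdFlow κF c W e x' univ ∂m₀
        = ∫⁻ x', fwdFlow κF c W e x' (Prod.mk true ⁻¹' B) +
            fwdFlow κF c W e x' (Prod.mk true ⁻¹' B)ᶜ ∂m₀ :=
          lintegral_congr fun x' => (fwdFlow_add_compl κF c hW he x' hBt).symm
      _ = 0 := by
          rw [lintegral_add_left (measurable_fwdFlow κF c hW he hBt), h2, ← Set.preimage_compl, h1,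
            add_zero]
  exact hm₀ (by rw [measure_eq_zero_of_lintegral_fwdFlow_univ κF c hW he hsum, Measure.coe_zero, Pi.zero_apply])

/-- **Within the target level**: if `m₁ ≠ 0` lies below every row of `T₁`, an almost-invariant `B`
cannot split the target level — `μ(B ∩ target) = 0` or `μ(Bᶜ ∩ target) = 0`. -/
theorem ncmc_targetLevel_dichotomy (hW : Measurable W) (hs : Measurable s) (hm₁ : m₁ univ ≠ 0)
    (hmin₁ : ∀ z, m₁ ≤ T₁ z) {μ : Measure (Bool × Ω)} {B : Set (Bool × Ω)} (hB : MeasurableSet B)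
    (hout : ∀ᵐ z ∂μ, z ∈ B → (switchKernel κF κR c W s e ∘ₖ levelKernel T₀ T₁) z Bᶜ = 0)
    (hin : ∀ᵐ z ∂μ, z ∉ B → (switchKernel κF κR c W s e ∘ₖ levelKernel T₀ T₁) z B = 0) :
    μ (B ∩ targetLevel Ω) = 0 ∨ μ (Bᶜ ∩ targetLevel Ω) = 0 := by
  by_contra hnot
  obtain ⟨hB1, hB2⟩ := not_or.1 hnot
  obtain ⟨z, hz, hzout⟩ := exists_of_ae_imp
    (hout.mono fun z hz hzB => hz hzB.1 : ∀ᵐ z ∂μ, z ∈ B ∩ targetLevel Ω → _) hB1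
  obtain ⟨z', hz', hzin⟩ := exists_of_ae_imp
    (hin.mono fun z hz hzB => hz hzB.1 : ∀ᵐ z ∂μ, z ∈ Bᶜ ∩ targetLevel Ω → _) hB2
  have hz1 : z = (true, z.2) := Prod.ext (by simpa using hz.2) rfl
  have hz1' : z' = (true, z'.2) := Prod.ext (by simpa using hz'.2) rfl
  rw [hz1] at hzout
  rw [hz1'] at hzin
  have h1 : ∫⁻ y', revFlow κR c W s y' (Prod.mk false ⁻¹' Bᶜ) ∂m₁ = 0 :=
    le_antisymm ((lintegral_revFlow_le_iteration T₀ T₁ hW hs (hmin₁ z.2) hB.compl).trans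
      hzout.le) bot_le
  have h2 : ∫⁻ y', revFlow κR c W s y' (Prod.mk false ⁻¹' B) ∂m₁ = 0 :=
    le_antisymm ((lintegral_revFlow_le_iteration T₀ T₁ hW hs (hmin₁ z'.2) hB).trans hzin.le)
      bot_le
  have hsum : ∫⁻ y', revFlow κR c W s y' univ ∂m₁ = 0 := by
    have hBf : MeasurableSet (Prod.mk false ⁻¹' B) := measurable_prodMk_left hB
    calc ∫⁻ y', revFlow κR c W s y' univ ∂m₁
        = ∫⁻ y', revFlow κR c W s y' (Prod.mk false ⁻¹' B) +
            revFlow κR c W s y' (Prod.mk false ⁻¹' B)ᶜ ∂m₁ :=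
          lintegral_congr fun y' => (revFlow_add_compl κR c hW hs y' hBf).symm
      _ = 0 := by
          rw [lintegral_add_left (measurable_revFlow κR c hW hs hBf), h2, ← Set.preimage_compl, h1,
            add_zero]
  exact hm₁ (by rw [measure_eq_zero_of_lintegral_revFlow_univ κR c hW hs hsum, Measure.coe_zero, Pi.zero_apply])

variable [IsFiniteMeasure ν₀] [IsFiniteMeasure ν₁]

/-- `π_c`-null sets are `Π_c`-null sets. -/
theorem jointLaw_apply_eq_zero_iff (c : ℝ) (ν₀ ν₁ : Measure Ω) [IsFiniteMeasure ν₀]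
    [IsFiniteMeasure ν₁] (S : Set (Bool × Ω)) :
    ((jointWeight c ν₀ ν₁ univ)⁻¹ • jointWeight c ν₀ ν₁) S = 0 ↔ jointWeight c ν₀ ν₁ S = 0 := by
  haveI := isFiniteMeasure_jointWeight c ν₀ ν₁
  rw [Measure.smul_apply, smul_eq_mul, mul_eq_zero, or_iff_right]
  exact ENNReal.inv_ne_zero.2 (measure_ne_top _ _)

/-- **Across the levels, I**: an almost-invariant `B` that misses the prior level and exhausts the
target level is impossible (forward records end `ν₁`-a.s. inside `B`, so `π_c`-almost every prior
state enters `B` with positive probability). -/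
theorem CrooksPair.ncmc_false_of_essTarget (h : CrooksPair ν₀ ν₁ κF κR s e W) (h0 : ν₀ univ ≠ 0)
    (hT₀ : Kernel.Invariant T₀ ν₀) (hm₀ : m₀ univ ≠ 0) (hmin₀ : ∀ z, m₀ ≤ T₀ z)
    {B : Set (Bool × Ω)} (hB : MeasurableSet B)
    (hBF : ((jointWeight c ν₀ ν₁ univ)⁻¹ • jointWeight c ν₀ ν₁) (B ∩ (targetLevel Ω)ᶜ) = 0)
    (hBT : ((jointWeight c ν₀ ν₁ univ)⁻¹ • jointWeight c ν₀ ν₁) (Bᶜ ∩ targetLevel Ω) = 0)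
    (hin : ∀ᵐ z ∂((jointWeight c ν₀ ν₁ univ)⁻¹ • jointWeight c ν₀ ν₁),
      z ∉ B → (switchKernel κF κR c W s e ∘ₖ levelKernel T₀ T₁) z B = 0) : False := by
  set π := (jointWeight c ν₀ ν₁ univ)⁻¹ • jointWeight c ν₀ ν₁ with hπ
  haveI := isFiniteMeasure_jointWeight c ν₀ ν₁
  have hBt : MeasurableSet (Prod.mk true ⁻¹' B) := measurable_prodMk_left hB
  -- the prior level has positive mass, all of it off `B`
  have hF : π (targetLevel Ω)ᶜ ≠ 0 := by
    rw [ne_eq, jointLaw_apply_eq_zero_iff c ν₀ ν₁, jointWeight_compl_targetLevel]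
    exact h0
  have hBcF : π (Bᶜ ∩ (targetLevel Ω)ᶜ) ≠ 0 := by
    intro hz
    apply hF
    rw [← measure_inter_add_sdiff (targetLevel Ω)ᶜ hB, Set.inter_comm, hBF, Set.sdiff_eq,
      Set.inter_comm, hz, add_zero]
  obtain ⟨z, hz, hzin⟩ := exists_of_ae_imp
    (hin.mono fun z hz hzB => hz hzB.1 : ∀ᵐ z ∂π, z ∈ Bᶜ ∩ (targetLevel Ω)ᶜ → _) hBcF
  have hz1 : z = (false, z.2) := Prod.ext (Bool.eq_false_iff.2 (by simpa using hz.2)) rfl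
  rw [hz1] at hzin
  have hint : ∫⁻ x', fwdFlow κF c W e x' (Prod.mk true ⁻¹' B) ∂m₀ = 0 :=
    le_antisymm ((lintegral_fwdFlow_le_iteration T₀ T₁ h.measurable_W h.measurable_e (hmin₀ z.2)
      hB).trans hzin.le) bot_le
  -- the target level is `ν₁`-a.s. inside `B`
  have hν₁ : ν₁ (Prod.mk true ⁻¹' B)ᶜ = 0 := by
    have hz : jointWeight c ν₀ ν₁ (Bᶜ ∩ targetLevel Ω) = 0 :=
      (jointLaw_apply_eq_zero_iff c ν₀ ν₁ _).1 hBT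
    rw [jointWeight_apply c ν₀ ν₁ (hB.compl.inter measurableSet_targetLevel), add_eq_zero,
      mul_eq_zero] at hz
    have hpre : Prod.mk true ⁻¹' (Bᶜ ∩ targetLevel Ω) = (Prod.mk true ⁻¹' B)ᶜ := by
      ext y; simp [targetLevel]
    rw [← hpre]
    exact hz.2.resolve_left (by rw [ENNReal.ofReal_eq_zero, not_le]; exact Real.exp_pos c)
  -- hence the accepted forward flow into `B_target` is the whole acceptance mass, `m₀`-a.e.
  have hae : ∀ᵐ x' ∂m₀, fwdFlow κF c W e x' (Prod.mk true ⁻¹' B) = fwdFlow κF c W e x' univ :=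
    (absolutelyContinuous_of_le_invariant hmin₀ hT₀ h0).ae_le (h.ae_fwdFlow_eq_univ c hBt hν₁)
  rw [lintegral_congr_ae hae] at hint
  exact hm₀ (by rw [measure_eq_zero_of_lintegral_fwdFlow_univ κF c h.measurable_W h.measurable_e
    hint, Measure.coe_zero, Pi.zero_apply])

/-- **Across the levels, II**: an almost-invariant `B` that misses the target level and exhausts the
prior level is impossible (reverse records start `ν₀`-a.s. inside `B`). -/
theorem CrooksPair.ncmc_false_of_essPrior (h : CrooksPair ν₀ ν₁ κF κR s e W)
    (h1 : ν₁ univ ≠ 0) (hT₁ : Kernel.Invariant T₁ ν₁) (hm₁ : m₁ univ ≠ 0) (hmin₁ : ∀ z, m₁ ≤ T₁ z)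
    {B : Set (Bool × Ω)} (hB : MeasurableSet B)
    (hBF : ((jointWeight c ν₀ ν₁ univ)⁻¹ • jointWeight c ν₀ ν₁) (Bᶜ ∩ (targetLevel Ω)ᶜ) = 0)
    (hBT : ((jointWeight c ν₀ ν₁ univ)⁻¹ • jointWeight c ν₀ ν₁) (B ∩ targetLevel Ω) = 0)
    (hin : ∀ᵐ z ∂((jointWeight c ν₀ ν₁ univ)⁻¹ • jointWeight c ν₀ ν₁),
      z ∉ B → (switchKernel κF κR c W s e ∘ₖ levelKernel T₀ T₁) z B = 0) : False := by
  set π := (jointWeight c ν₀ ν₁ univ)⁻¹ • jointWeight c ν₀ ν₁ with hπ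
  haveI := isFiniteMeasure_jointWeight c ν₀ ν₁
  have hBf : MeasurableSet (Prod.mk false ⁻¹' B) := measurable_prodMk_left hB
  have hT : π (targetLevel Ω) ≠ 0 := by
    rw [ne_eq, jointLaw_apply_eq_zero_iff c ν₀ ν₁, jointWeight_targetLevel, mul_eq_zero, not_or]
    exact ⟨by rw [ENNReal.ofReal_eq_zero, not_le]; exact Real.exp_pos c, h1⟩
  have hBcT : π (Bᶜ ∩ targetLevel Ω) ≠ 0 := by
    intro hz
    apply hT
    rw [← measure_inter_add_sdiff (targetLevel Ω) hB, Set.inter_comm, hBT, Set.sdiff_eq,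
      Set.inter_comm, hz, add_zero]
  obtain ⟨z, hz, hzin⟩ := exists_of_ae_imp
    (hin.mono fun z hz hzB => hz hzB.1 : ∀ᵐ z ∂π, z ∈ Bᶜ ∩ targetLevel Ω → _) hBcT
  have hz1 : z = (true, z.2) := Prod.ext (by simpa using hz.2) rfl
  rw [hz1] at hzin
  have hint : ∫⁻ y', revFlow κR c W s y' (Prod.mk false ⁻¹' B) ∂m₁ = 0 :=
    le_antisymm ((lintegral_revFlow_le_iteration T₀ T₁ h.measurable_W h.measurable_s (hmin₁ z.2)
      hB).trans hzin.le) bot_le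
  have hν₀ : ν₀ (Prod.mk false ⁻¹' B)ᶜ = 0 := by
    have hz : jointWeight c ν₀ ν₁ (Bᶜ ∩ (targetLevel Ω)ᶜ) = 0 :=
      (jointLaw_apply_eq_zero_iff c ν₀ ν₁ _).1 hBF
    rw [jointWeight_apply c ν₀ ν₁ (hB.compl.inter measurableSet_targetLevel.compl),
      add_eq_zero] at hz
    have hpre : Prod.mk false ⁻¹' (Bᶜ ∩ (targetLevel Ω)ᶜ) = (Prod.mk false ⁻¹' B)ᶜ := by
      ext x; simp [targetLevel]
    rw [← hpre]
    exact hz.1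
  have hae : ∀ᵐ y' ∂m₁, revFlow κR c W s y' (Prod.mk false ⁻¹' B) = revFlow κR c W s y' univ :=
    (absolutelyContinuous_of_le_invariant hmin₁ hT₁ h1).ae_le (h.ae_revFlow_eq_univ c hBf hν₀)
  rw [lintegral_congr_ae hae] at hint
  exact hm₁ (by rw [measure_eq_zero_of_lintegral_revFlow_univ κR c h.measurable_W h.measurable_s
    hint, Measure.coe_zero, Pi.zero_apply])

/-- **THE CERTIFICATE.**  For a Crooks pair between finite non-zero level weights, level samplers
`T₀`, `T₁` leaving `ν₀`, `ν₁` invariant and minorised by non-zero measures `m₀`, `m₁`, and ANY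
constant `c`: every measurable set almost invariant for the iteration kernel
`switchKernel ∘ₖ levelKernel T₀ T₁` under `π_c` is `π_c`-trivial. -/
theorem CrooksPair.ncmc_ae_invariant_trivial (h : CrooksPair ν₀ ν₁ κF κR s e W) (h0 : ν₀ univ ≠ 0)
    (h1 : ν₁ univ ≠ 0) (hT₀ : Kernel.Invariant T₀ ν₀) (hT₁ : Kernel.Invariant T₁ ν₁)
    (hm₀ : m₀ univ ≠ 0) (hm₁ : m₁ univ ≠ 0) (hmin₀ : ∀ z, m₀ ≤ T₀ z) (hmin₁ : ∀ z, m₁ ≤ T₁ z)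
    (B : Set (Bool × Ω)) (hB : MeasurableSet B)
    (hout : ∀ᵐ z ∂((jointWeight c ν₀ ν₁ univ)⁻¹ • jointWeight c ν₀ ν₁),
      z ∈ B → (switchKernel κF κR c W s e ∘ₖ levelKernel T₀ T₁) z Bᶜ = 0)
    (hin : ∀ᵐ z ∂((jointWeight c ν₀ ν₁ univ)⁻¹ • jointWeight c ν₀ ν₁),
      z ∉ B → (switchKernel κF κR c W s e ∘ₖ levelKernel T₀ T₁) z B = 0) :
    ((jointWeight c ν₀ ν₁ univ)⁻¹ • jointWeight c ν₀ ν₁) B = 0 ∨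
      ((jointWeight c ν₀ ν₁ univ)⁻¹ • jointWeight c ν₀ ν₁) B = 1 := by
  set π := (jointWeight c ν₀ ν₁ univ)⁻¹ • jointWeight c ν₀ ν₁ with hπ
  haveI : IsProbabilityMeasure π := isProbabilityMeasure_jointLaw c ν₀ ν₁ h0
  have hF := ncmc_priorLevel_dichotomy (κR := κR) (s := s) (T₁ := T₁) h.measurable_W h.measurable_e
    hm₀ hmin₀ hB hout hin
  have hT := ncmc_targetLevel_dichotomy (κF := κF) (e := e) (T₀ := T₀) h.measurable_W
    h.measurable_s hm₁ hmin₁ hB hout hin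
  rcases hF with hF1 | hF2 <;> rcases hT with hT1 | hT2
  · left
    rw [← measure_inter_add_sdiff B measurableSet_targetLevel, Set.sdiff_eq, hT1, hF1, add_zero]
  · exact (h.ncmc_false_of_essTarget h0 hT₀ hm₀ hmin₀ hB hF1 hT2 hin).elim
  · exact (h.ncmc_false_of_essPrior h1 hT₁ hm₁ hmin₁ hB hF2 hT1 hin).elim
  · right
    refine (prob_compl_eq_zero_iff hB).1 ?_
    rw [← measure_inter_add_sdiff Bᶜ measurableSet_targetLevel, Set.sdiff_eq, hT2, hF2, add_zero]

/-! ## §2 The engine's expanded-ensemble chain is ergodic; the reported numbers are consistent -/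

/-- **THE NCMC CHAIN IS ERGODIC.**  For a Crooks pair between finite non-zero level weights, level
samplers leaving their weights invariant and minorised by non-zero measures, and ANY `c`: the
expanded-ensemble chain of `latflow-snf`'s `run_ncmc_chain` (iteration kernel
`switchKernel ∘ₖ levelKernel T₀ T₁`) started in `π_c` is ergodic for the shift. -/
theorem CrooksPair.ergodic_ncmcChain (h : CrooksPair ν₀ ν₁ κF κR s e W) (h0 : ν₀ univ ≠ 0)
    (h1 : ν₁ univ ≠ 0) [IsMarkovKernel T₀] [IsMarkovKernel T₁] (hT₀ : Kernel.Invariant T₀ ν₀)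
    (hT₁ : Kernel.Invariant T₁ ν₁) [IsFiniteMeasure m₀] [IsFiniteMeasure m₁] (hm₀ : m₀ univ ≠ 0)
    (hm₁ : m₁ univ ≠ 0) (hmin₀ : ∀ z, m₀ ≤ T₀ z) (hmin₁ : ∀ z, m₁ ≤ T₁ z) (c : ℝ) :
    haveI := isMarkovKernel_switchKernel (κF := κF) (κR := κR) (c := c)
      h.measurable_W h.measurable_s h.measurable_e
    haveI := isMarkovKernel_levelKernel T₀ T₁
    haveI := isProbabilityMeasure_jointLaw c ν₀ ν₁ h0
    Ergodic (fun (z : ℕ → Bool × Ω) (k : ℕ) => z (k + 1))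
      (Kernel.trajMeasure (X := fun _ : ℕ => Bool × Ω)
        ((jointWeight c ν₀ ν₁ univ)⁻¹ • jointWeight c ν₀ ν₁)
        (fun n : ℕ => (switchKernel κF κR c W s e ∘ₖ levelKernel T₀ T₁).comap
          (fun hh : (j : ↥(Finset.Iic n)) → Bool × Ω => hh ⟨n, Finset.mem_Iic.2 le_rfl⟩)
          (measurable_pi_apply _))) := by
  haveI := isMarkovKernel_switchKernel (κF := κF) (κR := κR) (c := c)
    h.measurable_W h.measurable_s h.measurable_e
  haveI := isMarkovKernel_levelKernel T₀ T₁
  haveI := isProbabilityMeasure_jointLaw c ν₀ ν₁ h0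
  exact ergodic_shift_chain _ (invariant_smul _ (iteration_invariant h hT₀ hT₁ c) _)
    fun B hB hout hin => h.ncmc_ae_invariant_trivial h0 h1 hT₀ hT₁ hm₀ hm₁ hmin₀ hmin₁ B hB hout hin

/-- **THE REPORTED OCCUPANCY CONVERGES TO `σ(c − ΔF)` ALMOST SURELY** along the engine's
expanded-ensemble chain — unconditionally, for every Crooks pair with minorised invariant level
samplers and every `c`. -/
theorem CrooksPair.tendsto_occupancy_ae_ncmcChain (h : CrooksPair ν₀ ν₁ κF κR s e W)
    (h0 : ν₀ univ ≠ 0) (h1 : ν₁ univ ≠ 0) [IsMarkovKernel T₀] [IsMarkovKernel T₁]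
    (hT₀ : Kernel.Invariant T₀ ν₀) (hT₁ : Kernel.Invariant T₁ ν₁) [IsFiniteMeasure m₀]
    [IsFiniteMeasure m₁] (hm₀ : m₀ univ ≠ 0) (hm₁ : m₁ univ ≠ 0) (hmin₀ : ∀ z, m₀ ≤ T₀ z)
    (hmin₁ : ∀ z, m₁ ≤ T₁ z) (c : ℝ) {ΔF : ℝ}
    (hΔF : Real.exp (-ΔF) = ((ν₀ univ)⁻¹ * ν₁ univ).toReal) :
    haveI := isMarkovKernel_switchKernel (κF := κF) (κR := κR) (c := c)
      h.measurable_W h.measurable_s h.measurable_e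
    haveI := isMarkovKernel_levelKernel T₀ T₁
    haveI := isProbabilityMeasure_jointLaw c ν₀ ν₁ h0
    ∀ᵐ z ∂(Kernel.trajMeasure (X := fun _ : ℕ => Bool × Ω)
        ((jointWeight c ν₀ ν₁ univ)⁻¹ • jointWeight c ν₀ ν₁)
        (fun n : ℕ => (switchKernel κF κR c W s e ∘ₖ levelKernel T₀ T₁).comap
          (fun hh : (j : ↥(Finset.Iic n)) → Bool × Ω => hh ⟨n, Finset.mem_Iic.2 le_rfl⟩)
          (measurable_pi_apply _))),
      Tendsto (fun n : ℕ => (∑ i ∈ range n, (targetLevel Ω).indicator (1 : Bool × Ω → ℝ) (z i)) / n)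
        atTop (𝓝 (Real.sigmoid (c - ΔF))) := by
  haveI := isMarkovKernel_switchKernel (κF := κF) (κR := κR) (c := c)
    h.measurable_W h.measurable_s h.measurable_e
  haveI := isMarkovKernel_levelKernel T₀ T₁
  exact tendsto_occupancy_ae_chain _ h0 h1 (iteration_invariant h hT₀ hT₁ c) hΔF
    (h.ergodic_ncmcChain h0 h1 hT₀ hT₁ hm₀ hm₁ hmin₀ hmin₁ c)

/-- **`dF_occ` CONVERGES TO `ΔF` ALMOST SURELY** along the engine's expanded-ensemble chain —
unconditionally, for every Crooks pair with minorised invariant level samplers and every `c`. -/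
theorem CrooksPair.tendsto_dFocc_ae_ncmcChain (h : CrooksPair ν₀ ν₁ κF κR s e W)
    (h0 : ν₀ univ ≠ 0) (h1 : ν₁ univ ≠ 0) [IsMarkovKernel T₀] [IsMarkovKernel T₁]
    (hT₀ : Kernel.Invariant T₀ ν₀) (hT₁ : Kernel.Invariant T₁ ν₁) [IsFiniteMeasure m₀]
    [IsFiniteMeasure m₁] (hm₀ : m₀ univ ≠ 0) (hm₁ : m₁ univ ≠ 0) (hmin₀ : ∀ z, m₀ ≤ T₀ z)
    (hmin₁ : ∀ z, m₁ ≤ T₁ z) (c : ℝ) {ΔF : ℝ}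
    (hΔF : Real.exp (-ΔF) = ((ν₀ univ)⁻¹ * ν₁ univ).toReal) :
    haveI := isMarkovKernel_switchKernel (κF := κF) (κR := κR) (c := c)
      h.measurable_W h.measurable_s h.measurable_e
    haveI := isMarkovKernel_levelKernel T₀ T₁
    haveI := isProbabilityMeasure_jointLaw c ν₀ ν₁ h0
    ∀ᵐ z ∂(Kernel.trajMeasure (X := fun _ : ℕ => Bool × Ω)
        ((jointWeight c ν₀ ν₁ univ)⁻¹ • jointWeight c ν₀ ν₁)
        (fun n : ℕ => (switchKernel κF κR c W s e ∘ₖ levelKernel T₀ T₁).comap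
          (fun hh : (j : ↥(Finset.Iic n)) → Bool × Ω => hh ⟨n, Finset.mem_Iic.2 le_rfl⟩)
          (measurable_pi_apply _))),
      Tendsto (fun n : ℕ => c - Real.log
          ((∑ i ∈ range n, (targetLevel Ω).indicator (1 : Bool × Ω → ℝ) (z i)) / n /
            (1 - (∑ i ∈ range n, (targetLevel Ω).indicator (1 : Bool × Ω → ℝ) (z i)) / n)))
        atTop (𝓝 ΔF) := by
  haveI := isMarkovKernel_switchKernel (κF := κF) (κR := κR) (c := c)
    h.measurable_W h.measurable_s h.measurable_e
  haveI := isMarkovKernel_levelKernel T₀ T₁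
  exact tendsto_dFocc_ae_chain _ h0 h1 (iteration_invariant h hT₀ hT₁ c) hΔF
    (h.ergodic_ncmcChain h0 h1 hT₀ hT₁ hm₀ hm₁ hmin₀ hmin₁ c)

end Trivial

end Summit.Ventures.LatticeQCDFlow.Exactness.GeneralNCMC
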